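import Mathlib
import Summits.CriticalPhenomena.CardyFormulaZ2.Theorems.CardySelfRefinementGradientComparabilityOfKernels
import HarnessLib

/-!
# Crux `GradientComparability` (stmt-CriticalPhenomena-10269) — line `Sketch`: skeleton v3

Route `CardySelfRefinement`, sub-problem `CriticalPhenomena/CardyFormulaZ2`; card
`Ideas/level-curve-window-transport.md`.  Continuation lead c2 (2026-08-16).

The whole composition of the line is LANDED in the tree
(`…GradientComparabilityKernelsDictionary`, `…KernelsBulk`, `…OfKernels`: the reduction theorem
`gradientComparability_of_kernels : BET → W → R → CORNER → GradientComparability`, together with the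
≈ 45 helper files of cycles 1–2: Russo dictionaries, boundary values, uniform non-degeneracy along
the path, level-curve IFT, Grönwall transport, divergence at `(0,½)`).  This skeleton therefore only
carries the four OPEN registered stubs — the research kernels of the line — and the one-line glue
`GradientComparability_of`, which concludes the crux BY NAME.

* `stub_transversalSlopeLipschitz` (THE BET): the slope field `∂ρP/∂cP` is Lipschitz in `c` across
  the finite-size window, mesh-uniformly (open conjecture; = the route's rank-2 rate).
* `stub_Dc_windowStability` (W): Kesten's window stability of `∂cP` for `M_k` (not in print).
* `stub_Drho_le_window` (R): `|∂ρP| ≲ window⁻¹` at the path points (not in print).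
* `stub_cornerTwoCharts` (CORNER): Kesten tip of `M_k(1,0)` and the `c`-chart (not in print).
-/

noncomputable section

namespace Summit.CriticalPhenomena.CardyFormulaZ2.Theorems.CardySelfRefinement

open scoped Topology
open Filter Set MeasureTheory
open Literature.Probability.LatticeModels Literature.Probability.Percolation
open Literature.Probability.Percolation.QuadCrossing
open Summit.CriticalPhenomena.CardyFormulaZ2.Theses.CardySelfRefinement

/-! ## Stubs (the four research kernels) -/

/-- **THE BET — transversal slope bound.**  In the bulk `ρ ≤ 1 − δ` and for two fixed levels
`0 < vlo < vhi < 1`, the slope field `R = ∂ρP/∂cP` of the crossing polynomial `P_η` is Lipschitz in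
`c` ACROSS THE BAND `{vlo ≤ P_η(ρ,·) ≤ vhi}` with a MESH-UNIFORM constant `Θ`. -/
theorem stub_transversalSlopeLipschitz :
    ∀ k : ℕ, k = 2 ∨ k = 3 → ∀ γ : unitInterval → ℝ × ℝ, PathOK k γ →
      ∀ (m : ℕ) (F : Fin m → Quad (Set.univ : Set ℂ)), 0 < m → ∀ δ : ℝ, 0 < δ → δ ≤ 1 / 2 →
        ∀ vlo vhi : ℝ, 0 < vlo → vlo < vhi → vhi < 1 →
          ∃ Θ η₁ : ℝ, 0 ≤ Θ ∧ 0 < η₁ ∧ ∀ η ∈ Set.Ioo 0 η₁, ∀ ρ ∈ Set.Icc (0 : ℝ) (1 - δ),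
            ∀ c ∈ Set.Icc (0 : ℝ) 1, ∀ c' ∈ Set.Icc (0 : ℝ) 1,
              P k m F η ρ c ∈ Set.Icc vlo vhi → P k m F η ρ c' ∈ Set.Icc vlo vhi →
                |Dρ k m F η (ρ, c) / Dc k m F η (ρ, c) - Dρ k m F η (ρ, c') / Dc k m F η (ρ, c')| ≤
                  Θ * |c - c'| := by
  sorry

/-- **(W) Kesten's window stability of `∂cP` for `M_k`.**  In the bulk `ρ ≤ 1 − δ` and for two
fixed levels: across the finite-size window `{c ∈ [0,1] : P_η(ρ,c) ∈ [vlo, vhi]}` the Russo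
derivative `∂cP` varies by at most a MESH-UNIFORM factor `Λ₂`. -/
theorem stub_Dc_windowStability :
    ∀ k : ℕ, k = 2 ∨ k = 3 → ∀ γ : unitInterval → ℝ × ℝ, PathOK k γ →
      ∀ (m : ℕ) (F : Fin m → Quad (Set.univ : Set ℂ)), 0 < m → ∀ δ : ℝ, 0 < δ → δ ≤ 1 / 2 →
        ∀ vlo vhi : ℝ, 0 < vlo → vlo < vhi → vhi < 1 →
          ∃ Λ₂ η₂ : ℝ, 0 < Λ₂ ∧ 0 < η₂ ∧ ∀ η ∈ Set.Ioo 0 η₂, ∀ ρ ∈ Set.Icc (0 : ℝ) (1 - δ),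
            ∀ c ∈ Set.Icc (0 : ℝ) 1, ∀ c' ∈ Set.Icc (0 : ℝ) 1,
              P k m F η ρ c ∈ Set.Icc vlo vhi → P k m F η ρ c' ∈ Set.Icc vlo vhi →
                Dc k m F η (ρ, c) ≤ Λ₂ * Dc k m F η (ρ, c') := by
  sorry

/-- **(R) The `ρ`-derivative is at most window size at the path points.**  In the bulk and for
level selections `cm, cp` of `P_η(ρ,·)` at two fixed levels: `|∂ρP(γ s)| · (cp − cm)(ρ_s) ≤ Λ₃`
mesh-uniformly. -/
theorem stub_Drho_le_window :
    ∀ k : ℕ, k = 2 ∨ k = 3 → ∀ γ : unitInterval → ℝ × ℝ, PathOK k γ →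
      ∀ (m : ℕ) (F : Fin m → Quad (Set.univ : Set ℂ)), 0 < m → ∀ δ : ℝ, 0 < δ → δ ≤ 1 / 2 →
        ∀ vlo vhi : ℝ, 0 < vlo → vlo < vhi → vhi < 1 →
          ∃ Λ₃ η₃ : ℝ, 0 < Λ₃ ∧ 0 < η₃ ∧ ∀ η ∈ Set.Ioo 0 η₃, ∀ cm cp : ℝ → ℝ,
            (∀ ρ ∈ Set.Icc (0 : ℝ) (1 - δ), cm ρ ∈ Set.Icc (0 : ℝ) 1 ∧ cp ρ ∈ Set.Icc (0 : ℝ) 1 ∧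
                P k m F η ρ (cm ρ) = vlo ∧ P k m F η ρ (cp ρ) = vhi) →
            ∀ s : unitInterval, (γ s).1 ≤ 1 - δ →
              |Dρ k m F η (γ s)| * (cp (γ s).1 - cm (γ s).1) ≤ Λ₃ := by
  sorry

/-- **(CORNER) The two corner charts near the endpoint `(1,0)`.**  A mesh-dependent width
`w(η) → 0⁺` and two sub-charts sharing it: the TIP `{s | 1 − a·w(η) ≤ ρ_s}` (comparability for
every aperture `a > 0`) and the `c`-CHART `{s | 1 − 2δ ≤ ρ_s ≤ 1 − a·w(η)}` (comparability for some
aperture and depth). -/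
theorem stub_cornerTwoCharts :
    ∀ k : ℕ, k = 2 ∨ k = 3 → ∀ γ : unitInterval → ℝ × ℝ, PathOK k γ →
      ∀ (m : ℕ) (F : Fin m → Quad (Set.univ : Set ℂ)), 0 < m →
        ∃ w : ℝ → ℝ, Tendsto w (𝓝[>] 0) (𝓝 0) ∧ (∀ η : ℝ, 0 < η → 0 < w η) ∧
          (∀ a : ℝ, 0 < a → ∃ Λ₃ η₃ : ℝ, 0 < η₃ ∧ ∀ η ∈ Set.Ioo 0 η₃, ∀ s s' : unitInterval,
            1 - a * w η ≤ (γ s).1 → 1 - a * w η ≤ (γ s').1 →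
              |Dρ k m F η (γ s)| + |Dc k m F η (γ s)| ≤
                Λ₃ * (|Dρ k m F η (γ s')| + |Dc k m F η (γ s')|)) ∧
          (∃ a δ : ℝ, 0 < a ∧ 0 < δ ∧ δ ≤ 1 / 2 ∧ ∃ Λ₄ η₄ : ℝ, 0 < η₄ ∧
            ∀ η ∈ Set.Ioo 0 η₄, ∀ s s' : unitInterval,
              1 - 2 * δ ≤ (γ s).1 → (γ s).1 ≤ 1 - a * w η →
              1 - 2 * δ ≤ (γ s').1 → (γ s').1 ≤ 1 - a * w η →
                |Dρ k m F η (γ s)| + |Dc k m F η (γ s)| ≤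
                  Λ₄ * (|Dρ k m F η (γ s')| + |Dc k m F η (γ s')|)) := by
  sorry

/-! ## Composition (sorry-free glue: the landed reduction theorem) -/

/-- **The line closes the crux modulo its four stubs: `GradientComparability` by name**, through
the landed reduction `gradientComparability_of_kernels` (file `…GradientComparabilityOfKernels`). -/
theorem GradientComparability_of : GradientComparability :=
  gradientComparability_of_kernels stub_transversalSlopeLipschitz stub_Dc_windowStability
    stub_Drho_le_window stub_cornerTwoCharts

end Summit.CriticalPhenomena.CardyFormulaZ2.Theorems.CardySelfRefinement

end
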